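import Mathlib.FieldTheory.Finite.Basic
import Mathlib.FieldTheory.AbsoluteGaloisGroup
import Mathlib.RingTheory.PowerSeries.Exp
import Mathlib.RingTheory.PowerSeries.Substitution
import Mathlib.RingTheory.PowerSeries.Order
import Mathlib.Algebra.Polynomial.Reverse
import Mathlib.Analysis.Complex.Basic
import Mathlib.Analysis.SpecialFunctions.Pow.Real
import Mathlib.AlgebraicGeometry.Morphisms.FiniteType
import Literature.AlgebraicGeometry.Motives.Varieties
import Literature.AlgebraicGeometry.Motives.AlgPoints
import Literature.NumberTheory.GaloisRepresentations.AbsGaloisGroup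
import HarnessLib

-- provenance: harness21/H21/H21/Prelude/MotiveL/ZetaFunction.lean @ 0c3bcbe (interim HEAD d8f2665); M5 mechanical rewrite
/-!
# Zeta functions of schemes over a finite field (trunk MotiveL, prelude C3)

For a finite field `k` (`[Field k] [Finite k]`, `q = Nat.card k`) and a `k`-scheme
`X : Literature.SchemeOver k`, we define honestly

* the arithmetic Frobenius `Literature.arithFrob k : Field.absoluteGaloisGroup k` (`x ↦ x ^ q` on
  `k̄ = AlgebraicClosure k`, Mathlib `FiniteField.frobeniusAlgEquivOfAlgebraic`) and the
  geometric Frobenius `Literature.geomFrob k := (arithFrob k)⁻¹`;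
* the action of `Γ_k = Field.absoluteGaloisGroup k` on `X(k̄) = AlgPoints X k̄`
  (`AlgPoints.instMulActionAbsoluteGaloisGroup`, a transport of G17's
  `AlgPoints.instMulActionAlgEquiv` through the non-reducible `def Field.absoluteGaloisGroup`);
* the point counts `N_m = #X(𝔽_{q^m})`, as `Literature.pointCount X m := #{P ∈ X(k̄) | Frob^m P = P}`
  and `Literature.pointCountOver X L := # X(L)`;
* the zeta function `Z(X, T) = exp (∑_{m ≥ 1} N_m T^m / m) ∈ ℚ⟦T⟧` (`Literature.AlgebraicGeometry.Motives.zetaSeries`, via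
  Mathlib `PowerSeries.exp` and `PowerSeries.subst`) and its logarithm `Literature.AlgebraicGeometry.Motives.logZetaSeries`;
* the shape of the Weil conjectures: `Literature.IsWeilFactorization q n Z P`
  (`Z = P₁ P₃ ⋯ P_{2n-1} / (P₀ P₂ ⋯ P_{2n})`, `P₀ = 1 - T`, `P_{2n} = 1 - qⁿ T`, Riemann
  hypothesis `|α| = q^{i/2}` for the reciprocal roots of `P_i`) and the functional equation
  `Literature.HasFunctionalEquation q n Z χ` (`Z(1/(qⁿT)) = ± q^{nχ/2} T^χ Z(T)`), in cross-multiplied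
  polynomial form.

## Sources

* A. Weil, *Numbers of solutions of equations in finite fields*, Bull. AMS 55 (1949).
* J.-P. Serre, *Zeta and L functions*, in Arithmetical Algebraic Geometry (1965), §1.
* P. Deligne, *La conjecture de Weil. I*, Publ. Math. IHÉS 43 (1974), §1.
* R. Hartshorne, *Algebraic Geometry*, Appendix C, §1.

## Design notes

* Mathlib has no zeta function of a scheme over a finite field, no Frobenius morphism of schemes
  and no point counting for schemes (searched: `pointCount` exists only in
  `Combinatorics/Configuration`; `frobeniusAlgEquivOfAlgebraic`, `PowerSeries.exp`,
  `PowerSeries.subst`, `Polynomial.reflect` are reused).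
* **Frobenius conventions (OUTLINE §1(d)).** `arithFrob k` is the arithmetic Frobenius
  `x ↦ x^q`; the geometric Frobenius is its inverse. Fixed points of `arithFrob k ^ m` and of
  `geomFrob k ^ m` on `X(k̄)` coincide, so `pointCount` is convention-free; the distinction
  matters only downstream (trace formula, local factors `det(1 - T·Frob | Hⁱ)` use `geomFrob`).
* `Field.absoluteGaloisGroup` is a non-reducible `def`, so G17's
  `AlgPoints.instMulActionAlgEquiv` is not found by instance search on `Γ_k`; we transport it
  with `inferInstanceAs` (no Mathlib instance exists, nothing is overridden), exactly as
  `Literature.Prelude.GalRep.AbsGaloisGroup` does for the action on `k̄`.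
* Mathlib's `FiniteField.frobeniusAlgEquivOfAlgebraic` needs `[Fintype k]`; we assume only
  `[Finite k]` and use `Fintype.ofFinite` locally, stating everything with `Nat.card k`.
* **Junk values.** `pointCount X m` and `pointCountOver X L` are `Nat.card`s, hence `0` when the
  set of points is infinite (e.g. `X` not quasi-compact). Every theorem about them assumes
  `[LocallyOfFiniteType X.hom] [QuasiCompact X.hom]` (or is true unconditionally).
* `HasFunctionalEquation` avoids `RatFunc.eval` (whose junk value at poles would make the
  statement meaningless): it asks for a presentation `Z = A/B` by polynomials and states the
  functional equation of `A/B` after clearing denominators and powers of `T`, over `ℝ` because of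
  the factor `q^{nχ/2}`.
-/

universe u

open CategoryTheory AlgebraicGeometry MonoidalCategory Polynomial

noncomputable section

namespace Literature.AlgebraicGeometry.Motives

variable {k : Type u} [Field k]

/-! ### The action of the absolute Galois group on `k̄`-points -/

namespace AlgPoints

/-- The LEFT action of the absolute Galois group `Γ_k = Gal(k̄/k)` on the `k̄`-points `X(k̄)` of a
`k`-scheme, `σ • P = Spec σ ≫ P`: the transport of `AlgPoints.instMulActionAlgEquiv` through the
(non-reducible) definition `Field.absoluteGaloisGroup k = (k̄ ≃ₐ[k] k̄)`. No Mathlib instance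
exists, so nothing is overridden (Hartshorne, *Algebraic Geometry*, II Ex. 4.7; Serre, *Zeta and
L functions*, §1). [folklore] -/
instance instMulActionAbsoluteGaloisGroup (X : SchemeOver k) :
    MulAction (Field.absoluteGaloisGroup k) (AlgPoints X (AlgebraicClosure k)) :=
  inferInstanceAs (MulAction (AlgebraicClosure k ≃ₐ[k] AlgebraicClosure k) _)

/-- Definition of the `Γ_k`-action on `X(k̄)`: `g • P = specMap g ≫ P`, where `g` is viewed as a
`k`-algebra automorphism of `k̄` via `Field.absoluteGaloisGroup.toAlgEquiv`
(Hartshorne II Ex. 4.7). [folklore] -/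
theorem absoluteGaloisGroup_smul_def {X : SchemeOver k} (g : Field.absoluteGaloisGroup k)
    (P : AlgPoints X (AlgebraicClosure k)) :
    g • P = AlgPoints.specMap (Field.absoluteGaloisGroup.toAlgEquiv k g) ≫ P := rfl

end AlgPoints

/-! ### Frobenius elements -/

section Frobenius

variable (k) [Finite k]

/-- The *arithmetic Frobenius* of a finite field `k` with `q` elements, as an element of the
absolute Galois group `Γ_k = Gal(k̄/k)`: the automorphism `x ↦ x ^ q` of `k̄`
(Mathlib `FiniteField.frobeniusAlgEquivOfAlgebraic`, which needs `[Fintype k]`; we use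
`Fintype.ofFinite`). It is a topological generator of `Γ_k ≅ ℤ̂`
(Serre, *Zeta and L functions*, §1; Deligne, *Weil I* (1974), (1.5)). [folklore] -/
def arithFrob : Field.absoluteGaloisGroup k :=
  letI := Fintype.ofFinite k
  FiniteField.frobeniusAlgEquivOfAlgebraic k (AlgebraicClosure k)

/-- The *geometric Frobenius* `F = φ⁻¹ ∈ Γ_k`, the inverse of the arithmetic Frobenius. This is
the element whose action on étale cohomology enters the Lefschetz trace formula and the local
factors `det(1 - T·F | Hⁱ)` (Deligne, *Weil I* (1974), (1.5); OUTLINE §1(d)). [folklore] -/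
def geomFrob : Field.absoluteGaloisGroup k := (arithFrob k)⁻¹

variable {k}

/-- The arithmetic Frobenius acts on `k̄` by `x ↦ x ^ q`, `q = Nat.card k`
(Serre, *Zeta and L functions*, §1). [folklore] -/
@[simp]
theorem arithFrob_smul (x : AlgebraicClosure k) : arithFrob k • x = x ^ Nat.card k := by
  letI := Fintype.ofFinite k
  rw [Nat.card_eq_fintype_card]
  rfl

/-- The geometric Frobenius is the inverse of the arithmetic one (by definition;
Deligne, *Weil I* (1974), (1.5)). [folklore] -/
@[simp]
theorem geomFrob_inv : (geomFrob k)⁻¹ = arithFrob k := inv_inv _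

/-- `geomFrob k • (x ^ q) = x`: the geometric Frobenius undoes `x ↦ x ^ q` on `k̄`
(Deligne, *Weil I* (1974), (1.5)). [folklore] -/
theorem geomFrob_smul_pow (x : AlgebraicClosure k) : geomFrob k • x ^ Nat.card k = x := by
  rw [← arithFrob_smul, geomFrob, inv_smul_smul]

/-- The arithmetic Frobenius topologically generates `Γ_k`: the cyclic subgroup `⟨φ⟩` is dense in
`Gal(k̄/k) ≅ ℤ̂` for the Krull topology (Serre, *Local Fields*, XIII §1; Serre, *Zeta and L
functions*, §1). [cite: SerreLocalFields1979, Ch. XIII §1] [cite: SerreZetaL1965, §1] -/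
def denseRange_zpowers_arithFrob : Prop :=
  DenseRange (fun n : ℤ => arithFrob k ^ n : ℤ → Field.absoluteGaloisGroup k)

end Frobenius

/-! ### Point counts -/

section PointCount

variable [Finite k] (X : SchemeOver k)

/-- The number `N_m = #X(𝔽_{q^m})` of points of `X` with values in the degree-`m` extension of
`k`, defined intrinsically as the number of `k̄`-points fixed by the `m`-th power of (arithmetic,
equivalently geometric) Frobenius (Weil 1949; Serre, *Zeta and L functions*, §1; Hartshorne,
App. C §1). Junk value: `Nat.card` of an infinite type is `0`, so `N_m = 0` if `X` has
infinitely many such points (e.g. `X` not quasi-compact); see `pointCount_eq_pointCountOver` and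
`finite_algPoints_of_finite` for the finite-type case. For `m = 0` this counts all of `X(k̄)`. [cite: Weil1949] -/
def pointCount (m : ℕ) : ℕ :=
  Nat.card {P : AlgPoints X (AlgebraicClosure k) // arithFrob k ^ m • P = P}

/-- The naive number of `L`-valued points `# X(L)` of `X` over a `k`-algebra field `L`
(typically a finite extension of `k`); `0` if `X(L)` is infinite (junk value of `Nat.card`)
(Weil 1949; Serre, *Zeta and L functions*, §1). [cite: Weil1949] -/
def pointCountOver (L : Type u) [Field L] [Algebra k L] : ℕ :=
  Nat.card (AlgPoints X L)

variable {X}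

/-- `N_m = # X(L)` for any extension `L/k` of degree `m ≥ 1` (so `L ≅ 𝔽_{q^m}`): an embedding
`L ↪ k̄` identifies `X(L)` with the `k̄`-points fixed by `Gal(k̄/L)`, which is topologically
generated by `φ^m` (Serre, *Zeta and L functions*, §1; Hartshorne, App. C §1). True without
finiteness hypotheses on `X` (both sides are then the junk value `0` simultaneously, the
underlying bijection being unconditional). [cite: SerreZetaL1965, §1] [cite: Hartshorne1977, App. C §1] -/
def pointCount_eq_pointCountOver : Prop :=
  ∀ {m : ℕ} (L : Type u) [Field L] [Algebra k L] [Finite L] (h : Module.finrank k L = m) (hm : 0 < m),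
    pointCount X m = pointCountOver X L

variable (X) in
/-- A scheme of finite type over `k` has finitely many points with values in a finite field
`L ⊇ k` (locally, `X(L) ⊆ Lⁿ`; quasi-compactness gives a finite affine cover)
(Hartshorne, App. C §1; Serre, *Zeta and L functions*, §1). Both hypotheses are needed: an
infinite disjoint union of copies of `Spec k` is locally of finite type with `X(k)` infinite. [cite: Hartshorne1977, App. C §1] -/
def finite_algPoints_of_finite : Prop :=
  ∀ [LocallyOfFiniteType X.hom] [QuasiCompact X.hom] (L : Type u) [Field L] [Algebra k L] [Finite L],
    Finite (AlgPoints X L)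

/-- For `X` of finite type over `k`, the set of `k̄`-points fixed by `φ^m`, `m ≥ 1`, is finite,
so `pointCount X m` is an honest cardinality (Hartshorne, App. C §1). [cite: Hartshorne1977, App. C §1] -/
def finite_fixedPoints_arithFrob_pow : Prop :=
  ∀ [LocallyOfFiniteType X.hom] [QuasiCompact X.hom] {m : ℕ} (hm : 0 < m),
    Finite {P : AlgPoints X (AlgebraicClosure k) // arithFrob k ^ m • P = P}

/-- The point `Spec k` has exactly one point over every `𝔽_{q^m}`: `N_m(Spec k) = 1`
(Serre, *Zeta and L functions*, §1, `Z(Spec 𝔽_q, T) = 1/(1 - T)`). [folklore] -/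
theorem pointCount_unit (m : ℕ) : pointCount (𝟙_ (SchemeOver k)) m = 1 := by
  haveI : Unique {P : AlgPoints (𝟙_ (SchemeOver k)) (AlgebraicClosure k) //
      arithFrob k ^ m • P = P} :=
    { default := ⟨CartesianMonoidalCategory.toUnit _, CartesianMonoidalCategory.toUnit_unique _ _⟩
      uniq := fun P => Subtype.ext (CartesianMonoidalCategory.toUnit_unique _ _) }
  exact Nat.card_unique

end PointCount

/-! ### The zeta function -/

section Zeta

variable [Finite k] (X : SchemeOver k)

/-- The logarithm of the zeta function, `log Z(X, T) = ∑_{m ≥ 1} N_m T^m / m ∈ ℚ⟦T⟧`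
(Weil 1949; Serre, *Zeta and L functions*, §1; Hartshorne, App. C, Def. p. 449). The `m = 0`
coefficient is `0` by definition. [cite: Weil1949] -/
def logZetaSeries : PowerSeries ℚ :=
  PowerSeries.mk fun m => if m = 0 then 0 else (pointCount X m : ℚ) / m

/-- Coefficients of `log Z(X, T)`: `N_m / m` for `m ≥ 1`, `0` for `m = 0`
(Serre, *Zeta and L functions*, §1). [folklore] -/
@[simp]
theorem coeff_logZetaSeries (m : ℕ) :
    PowerSeries.coeff m (logZetaSeries X) = if m = 0 then 0 else (pointCount X m : ℚ) / m :=
  PowerSeries.coeff_mk _ _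

/-- `log Z(X, T)` has zero constant term (Serre, *Zeta and L functions*, §1). [folklore] -/
@[simp]
theorem constantCoeff_logZetaSeries : PowerSeries.constantCoeff (logZetaSeries X) = 0 := by
  rw [← PowerSeries.coeff_zero_eq_constantCoeff_apply, coeff_logZetaSeries, if_pos rfl]

/-- `log Z(X, T)` may be substituted into a power series (its constant term vanishes), so that
`exp (log Z)` makes sense in `ℚ⟦T⟧` (Mathlib `PowerSeries.HasSubst.of_constantCoeff_zero'`). [folklore] -/
theorem hasSubst_logZetaSeries : PowerSeries.HasSubst (logZetaSeries X) :=
  PowerSeries.HasSubst.of_constantCoeff_zero' (constantCoeff_logZetaSeries X)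

/-- The *zeta function* of a scheme `X` over a finite field,
`Z(X, T) = exp (∑_{m ≥ 1} N_m T^m / m) ∈ ℚ⟦T⟧`, `N_m = pointCount X m`
(Weil 1949; Serre, *Zeta and L functions*, §1; Deligne, *Weil I* (1974), (1.6); Hartshorne,
App. C §1). Defined via Mathlib `PowerSeries.exp` and `PowerSeries.subst`. [cite: Weil1949] -/
def zetaSeries : PowerSeries ℚ :=
  (PowerSeries.exp ℚ).subst (logZetaSeries X)

/-- `Z(X, 0) = 1` (Serre, *Zeta and L functions*, §1). [folklore] -/
@[simp]
theorem constantCoeff_zetaSeries : PowerSeries.constantCoeff (zetaSeries X) = 1 := by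
  rw [zetaSeries, ← PowerSeries.coeff_zero_eq_constantCoeff_apply,
    PowerSeries.coeff_subst' (hasSubst_logZetaSeries X), finsum_eq_single _ 0]
  · simp
  · intro d hd
    rw [PowerSeries.coeff_zero_eq_constantCoeff_apply, map_pow, constantCoeff_logZetaSeries,
      zero_pow hd, smul_zero]

/-- The linear coefficient of `Z(X, T)` is `N_1 = # X(k)` (expand `exp`; Serre, *Zeta and L
functions*, §1). [folklore] -/
theorem coeff_one_zetaSeries : PowerSeries.coeff 1 (zetaSeries X) = pointCount X 1 := by
  rw [zetaSeries, PowerSeries.coeff_subst' (hasSubst_logZetaSeries X), finsum_eq_single _ 1]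
  · simp
  · intro d hd
    rcases Nat.lt_or_gt_of_ne hd with h | h
    · rw [Nat.lt_one_iff.mp h, pow_zero, PowerSeries.coeff_one, if_neg one_ne_zero, smul_zero]
    · rw [PowerSeries.coeff_of_lt_order 1, smul_zero]
      refine lt_of_lt_of_le ?_
        (PowerSeries.le_order_pow_of_constantCoeff_eq_zero d (constantCoeff_logZetaSeries X))
      exact_mod_cast h

end Zeta

/-! ### The shape of the Weil conjectures -/

section Weil

/-- The polynomial `T^N · p(c / T)` for `p ∈ R[T]` with `natDegree p ≤ N`:
`∑ᵢ pᵢ cⁱ T^{N-i}` (Mathlib `Polynomial.reflect` of `p(cT)`). Used to clear denominators in the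
functional equation `T ↦ 1/(qⁿ T)` (Hartshorne, App. C, (1.2)). [folklore] -/
def reflectScale {R : Type*} [CommSemiring R] (N : ℕ) (c : R) (p : R[X]) : R[X] :=
  Polynomial.reflect N (p.comp (C c * X))

/-- **Shape of the Weil conjectures** for a power series `Z ∈ ℚ⟦T⟧` thought of as `Z(X, T)` for
`X` smooth projective of dimension `n` over `𝔽_q` (Weil 1949, p. 507; Deligne, *Weil I* (1974),
(1.6); Hartshorne, App. C, Thms. 1.1–1.3): there are `P₀, …, P_{2n} ∈ ℤ[T]` with
* `P_i(0) = 1` for all `i`;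
* rationality `Z(T) · ∏_{i even} P_i(T) = ∏_{i odd} P_i(T)` in `ℚ⟦T⟧`, i.e.
  `Z = P₁ ⋯ P_{2n-1} / (P₀ P₂ ⋯ P_{2n})`;
* `P₀ = 1 - T` and `P_{2n} = 1 - qⁿ T`;
* (Riemann hypothesis) every complex root `z` of `P_i` has `|z| = q^{-i/2}`, i.e.
  `P_i(T) = ∏ⱼ (1 - α_{ij} T)` with `|α_{ij}| = q^{i/2}`.
The index `i : Fin (2 * n + 1)` runs over cohomological degrees `0, …, 2n`. [cite: Weil1949, p. 507] -/
def IsWeilFactorization (q n : ℕ) (Z : PowerSeries ℚ) (P : Fin (2 * n + 1) → ℤ[X]) : Prop :=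
  (∀ i, (P i).coeff 0 = 1) ∧
  Z * (∏ i ∈ (Finset.univ : Finset (Fin (2 * n + 1))) with Even i.val,
      ((P i).map (Int.castRingHom ℚ) : PowerSeries ℚ)) =
    ∏ i ∈ (Finset.univ : Finset (Fin (2 * n + 1))) with Odd i.val,
      ((P i).map (Int.castRingHom ℚ) : PowerSeries ℚ) ∧
  P 0 = 1 - X ∧
  P (Fin.last (2 * n)) = 1 - C ((q : ℤ) ^ n) * X ∧
  ∀ i (z : ℂ), ((P i).map (Int.castRingHom ℂ)).IsRoot z →
    ‖z‖ = (q : ℝ) ^ (-((i : ℕ) : ℝ) / 2)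

/-- **Functional equation** of `Z(X, T)` for `X` smooth projective of dimension `n` over `𝔽_q`
with Euler characteristic (self-intersection of the diagonal) `χ`
(Weil 1949; Deligne, *Weil I* (1974), (2.6); Hartshorne, App. C, Thm. 1.2):
`Z(1 / (qⁿ T)) = ± q^{n χ / 2} T^χ Z(T)`.
Stated without evaluating rational functions: `Z = A / B` for polynomials `A, B ∈ ℚ[T]` with
`B(0) ≠ 0` (`Z · B = A` in `ℚ⟦T⟧`), and, for `N ≥ deg A, deg B` and `Ã(T) = T^N A(1/(qⁿT))`,
`B̃(T) = T^N B(1/(qⁿT))` (see `reflectScale`), the cross-multiplied identity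
`T^{χ⁻} · Ã · B = ε · q^{nχ/2} · T^{χ⁺} · A · B̃` in `ℝ[T]` with a sign `ε = ±1`
(`χ⁺ = max χ 0`, `χ⁻ = max (-χ) 0`; real coefficients because of `q^{nχ/2}`). The identity is
independent of the choices of `A`, `B`, `N`. [cite: Weil1949] -/
def HasFunctionalEquation (q n : ℕ) (Z : PowerSeries ℚ) (χ : ℤ) : Prop :=
  ∃ (A B : ℚ[X]) (N : ℕ) (ε : ℤˣ), B.coeff 0 ≠ 0 ∧ Z * (B : PowerSeries ℚ) = A ∧
    A.natDegree ≤ N ∧ B.natDegree ≤ N ∧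
    X ^ (-χ).toNat * (reflectScale N ((q : ℚ) ^ n)⁻¹ A).map (algebraMap ℚ ℝ) *
        B.map (algebraMap ℚ ℝ) =
      C (((ε : ℤ) : ℝ) * (q : ℝ) ^ ((n : ℝ) * χ / 2)) * X ^ χ.toNat *
        A.map (algebraMap ℚ ℝ) * (reflectScale N ((q : ℚ) ^ n)⁻¹ B).map (algebraMap ℚ ℝ)

end Weil

end Literature.AlgebraicGeometry.Motives
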